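import Literature.NumberTheory.LFunctions.HilbertInequalityTwoPole

/-!
# The weighted Hilbert inequality, III: the eigenvector bound

The core of Shan's proof of the Montgomery–Vaughan weighted Hilbert inequality as printed in
Pan Chengdong–Pan Chengbiao, *Foundations of analytic number theory*, Ch. 28 §4, Theorem 4: let
`x : ι → ℝ` be a `δ`-separated configuration (`0 < δ_r ≤ |x_r - x_s|`, `r ≠ s`), `c_r = δ_r^{1/2}`,
and `K_{rs} = c_r c_s (x_r - x_s)^{-1}` (`K_{rr} = 0`).  If `v` is a unit vector with
`K v = iμ v` (`μ ∈ ℝ`), then `μ² ≤ 107/5 < (3π/2)²`.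

## Proof (loc. cit., (33)–(35))

`μ² = ‖Kv‖² = Σ₁ + Σ₂` with `Σ₁ = ∑_s |v_s|² δ_s ∑_r δ_r (x_r-x_s)^{-2} ≤ 4` and, after the partial
fraction expansion `K_{rs}K_{rt} = K_{st}(δ_r/(x_r-x_s) - δ_r/(x_r-x_t))` (`r ∉ {s,t}`) and the
cancellation `Σ₃ = Σ₅` coming from the eigen-equation, `|Σ₂| ≤ 2Σ₇`,
`Σ₇ = ∑_{s≠t} |v_s v_t| δ_s^{1/2} δ_t^{3/2} (x_s-x_t)^{-2}`; by Cauchy–Schwarz and the spacing lemmas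
(`sum_weight_div_pow_four_le`, `sum_weight_two_pole_le`) `Σ₇² ≤ 16/3 + 8Σ₇`, whence `Σ₇ ≤ 87/10`
and `μ² ≤ 4 + 2Σ₇ ≤ 107/5`.  (Pan–Pan use Shan's sharp `π²/3`, `π⁴/45` and get `19.82`; the crude
constants `4`, `16/3` of `HilbertInequalitySpacing` suffice for `3π/2`.)

## Sources

* Pan Chengdong, Pan Chengbiao, *解析数论基础*, Science Press 1991, Ch. 28 §4, Theorem 4.
* H. L. Montgomery, R. C. Vaughan, J. London Math. Soc. (2) 8 (1974) 73–82 (the eigenvalue method).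
* E. Preissmann, O. Lévêque, Pacific J. Math. 265 (2013), Lemma 5 (the identity behind `Σ₃ = Σ₅`).
-/

open Finset Real Complex
open scoped ComplexConjugate

namespace Literature.NumberTheory.LFunctions.MontgomeryVaughan

section Core

variable {ι : Type*} [Fintype ι] [DecidableEq ι] {x δ c : ι → ℝ} {K : ι → ι → ℝ}

/-! ### Full-sum forms of the spacing lemmas (the poles contribute `x/0 = 0`) -/

omit [Fintype ι] [DecidableEq ι] in
/-- `δ`-separation forces the configuration to be injective. [folklore] -/
theorem injective_of_sep (hδ : ∀ r, 0 < δ r) (hsep : ∀ r s, r ≠ s → δ r ≤ |x r - x s|) :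
    Function.Injective x := by
  intro r s h; by_contra hrs
  have := hsep r s hrs; rw [h, sub_self, abs_zero] at this; linarith [hδ r]

/-- `∑_r δ_r (x_r - x_s)^{-2} ≤ 4/δ_s` (pole term `= 0`). [cite: PanPan1991, Ch. 28 §4 Lemma 2] -/
theorem sum_univ_weight_div_sq_le (hδ : ∀ r, 0 < δ r) (hsep : ∀ r s, r ≠ s → δ r ≤ |x r - x s|)
    (s : ι) : ∑ r, δ r / (x r - x s) ^ 2 ≤ 4 / δ s := by
  rw [← Finset.sum_erase (Finset.univ) (a := s) (by simp)]
  exact sum_weight_div_sq_le hδ hsep s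

/-- `∑_r δ_r (x_r - x_s)^{-4} ≤ 16/(3δ_s³)` (pole term `= 0`). [cite: PanPan1991, Ch. 28 §4 Lemma 2] -/
theorem sum_univ_weight_div_pow_four_le (hδ : ∀ r, 0 < δ r)
    (hsep : ∀ r s, r ≠ s → δ r ≤ |x r - x s|) (s : ι) :
    ∑ r, δ r / (x r - x s) ^ 4 ≤ 16 / (3 * δ s ^ 3) := by
  rw [← Finset.sum_erase (Finset.univ) (a := s) (by simp)]
  exact sum_weight_div_pow_four_le hδ hsep s

/-- Two-pole sum over all `r` (pole terms `= 0`). [cite: PanPan1991, Ch. 28 §4 Lemma 3] -/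
theorem sum_univ_two_pole_le (hδ : ∀ r, 0 < δ r) (hsep : ∀ r s, r ≠ s → δ r ≤ |x r - x s|)
    {s t : ι} (hst : s ≠ t) :
    ∑ r, δ r / ((x r - x s) ^ 2 * (x r - x t) ^ 2) ≤ 4 * (1 / δ s + 1 / δ t) / (x s - x t) ^ 2 := by
  rw [← Finset.sum_erase (Finset.univ) (a := s) (by simp),
    ← Finset.sum_erase (Finset.univ.erase s) (a := t) (by simp)]
  exact sum_weight_two_pole_le hδ hsep hst

/-! ### The kernel identity `∑_r K_{rs} K_{rt}` -/

/-- The partial-fraction identity behind `‖Kv‖²` (Pan–Pan (33)–(34); Preissmann–Lévêque Lemma 5):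
`∑_r K_{rs}K_{rt} = [s=t] δ_s ∑_r δ_r/(x_r-x_s)² + K_{st}(P_s - P_t) + c_s c_t (δ_s+δ_t)/(x_s-x_t)²`
with `P_u = ∑_r δ_r/(x_r - x_u)` (all pole terms are `x/0 = 0`). [cite: PanPan1991, Ch. 28 §4 Theorem 4] -/
theorem sum_kernel_mul_kernel (hδ : ∀ r, 0 < δ r) (hsep : ∀ r s, r ≠ s → δ r ≤ |x r - x s|)
    (hc : ∀ r, c r = Real.sqrt (δ r)) (hK : ∀ r s, K r s = c r * c s / (x r - x s)) (s t : ι) :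
    ∑ r, K r s * K r t =
      (if s = t then δ s * ∑ r, δ r / (x r - x s) ^ 2 else 0) +
        K s t * (∑ r, δ r / (x r - x s) - ∑ r, δ r / (x r - x t)) +
        c s * c t * (δ s + δ t) / (x s - x t) ^ 2 := by
  have hinj := injective_of_sep hδ hsep
  have hcsq : ∀ r, δ r = c r ^ 2 := fun r => by rw [hc]; exact (Real.sq_sqrt (hδ r).le).symm
  have hKdiag : ∀ r, K r r = 0 := fun r => by rw [hK]; simp
  by_cases hst : s = t
  · subst hst
    simp only [if_true, sub_self, mul_zero, add_zero, ne_eq, OfNat.ofNat_ne_zero,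
      not_false_eq_true, zero_pow, div_zero]
    rw [Finset.mul_sum]
    refine Finset.sum_congr rfl fun r _ => ?_
    by_cases hr : x r - x s = 0
    · rw [hK, hr]; simp
    · rw [hK, hcsq, hcsq]; field_simp
  · have hxst : x s - x t ≠ 0 := sub_ne_zero.mpr fun h => hst (hinj h)
    set m : ι → ℝ := fun r => K s t * (δ r / (x r - x s) - δ r / (x r - x t)) with hm
    have hterm : ∀ r, K r s * K r t =
        m r - (if r = s then m s else 0) - (if r = t then m t else 0) := by
      intro r
      by_cases hrs : r = s
      · subst hrs; simp [hKdiag, hst]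
      · by_cases hrt : r = t
        · subst hrt; simp [hKdiag, hrs]
        · simp only [hrs, hrt, if_false, sub_zero, hm]
          have h1 : x r - x s ≠ 0 := sub_ne_zero.mpr fun h => hrs (hinj h)
          have h2 : x r - x t ≠ 0 := sub_ne_zero.mpr fun h => hrt (hinj h)
          rw [hK, hK, hK s t, hcsq r]
          field_simp
          ring
    simp only [hst, if_false, zero_add]
    calc ∑ r, K r s * K r t
          = ∑ r, (m r - (if r = s then m s else 0) - (if r = t then m t else 0)) :=
            Finset.sum_congr rfl fun r _ => hterm r
      _ = ∑ r, m r - m s - m t := by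
            rw [Finset.sum_sub_distrib, Finset.sum_sub_distrib, Finset.sum_ite_eq', Finset.sum_ite_eq']
            simp
      _ = _ := by
            simp only [hm, sub_self, div_zero, zero_sub, sub_zero]
            rw [← Finset.mul_sum, Finset.sum_sub_distrib, hK s t]
            rw [show x t - x s = -(x s - x t) by ring, div_neg]
            field_simp
            ring

/-! ### The eigenvector bound -/

omit [DecidableEq ι] in
/-- `μ² = ∑_{s,t} v_s v̄_t ∑_r K_{rs}K_{rt}` for a unit vector with `Kv = iμv`, `K` real.
[cite: PanPan1991, Ch. 28 §4 Theorem 4] -/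
theorem mu_sq_eq_sum (v : ι → ℂ) (μ : ℝ) (hv : ∑ r, ‖v r‖ ^ 2 = 1)
    (heig : ∀ r, ∑ s, (K r s : ℂ) * v s = I * μ * v r) :
    ((μ ^ 2 : ℝ) : ℂ) = ∑ s, ∑ t, v s * conj (v t) * ((∑ r, K r s * K r t : ℝ) : ℂ) := by
  have h1 : ∀ r, (∑ s, (K r s : ℂ) * v s) * conj (∑ t, (K r t : ℂ) * v t) =
      ((μ ^ 2 * ‖v r‖ ^ 2 : ℝ) : ℂ) := by
    intro r
    rw [heig r, map_mul, map_mul, Complex.conj_I, Complex.conj_ofReal]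
    have : v r * conj (v r) = ((‖v r‖ ^ 2 : ℝ) : ℂ) := by
      rw [Complex.mul_conj, Complex.normSq_eq_norm_sq]
    calc I * ↑μ * v r * (-I * ↑μ * conj (v r)) = -(I * I) * ↑μ ^ 2 * (v r * conj (v r)) := by ring
      _ = _ := by rw [Complex.I_mul_I, this]; push_cast; ring
  calc ((μ ^ 2 : ℝ) : ℂ) = ((μ ^ 2 * ∑ r, ‖v r‖ ^ 2 : ℝ) : ℂ) := by rw [hv, mul_one]
    _ = ∑ r, ((μ ^ 2 * ‖v r‖ ^ 2 : ℝ) : ℂ) := by push_cast; rw [Finset.mul_sum]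
    _ = ∑ r, (∑ s, (K r s : ℂ) * v s) * conj (∑ t, (K r t : ℂ) * v t) :=
          Finset.sum_congr rfl fun r _ => (h1 r).symm
    _ = ∑ r, ∑ s, ∑ t, (K r s : ℂ) * v s * ((K r t : ℂ) * conj (v t)) := by
          refine Finset.sum_congr rfl fun r _ => ?_
          rw [map_sum, Finset.sum_mul_sum]
          refine Finset.sum_congr rfl fun s _ => Finset.sum_congr rfl fun t _ => ?_
          rw [map_mul, Complex.conj_ofReal]
    _ = ∑ s, ∑ t, v s * conj (v t) * ((∑ r, K r s * K r t : ℝ) : ℂ) := by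
          rw [Finset.sum_comm]
          refine Finset.sum_congr rfl fun s _ => ?_
          rw [Finset.sum_comm]
          refine Finset.sum_congr rfl fun t _ => ?_
          push_cast
          rw [Finset.mul_sum]
          exact Finset.sum_congr rfl fun r _ => by ring

omit [DecidableEq ι] in
/-- The cancellation `Σ₃ = Σ₅` of Pan–Pan (35): for `Kv = iμv` with `K` real antisymmetric and any
real weights `P`, `∑_{s,t} v_s v̄_t K_{st}(P_s - P_t) = 0`. [cite: PanPan1991, Ch. 28 §4 Theorem 4] -/
theorem sum_cross_eq_zero (hanti : ∀ s t, K t s = -K s t) (P : ι → ℝ) (v : ι → ℂ) (μ : ℝ)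
    (heig : ∀ r, ∑ s, (K r s : ℂ) * v s = I * μ * v r) :
    ∑ s, ∑ t, v s * conj (v t) * ((K s t * (P s - P t) : ℝ) : ℂ) = 0 := by
  have hrow : ∀ s, ∑ t, (K s t : ℂ) * conj (v t) = conj (I * μ * v s) := by
    intro s
    rw [← heig s, map_sum]
    exact Finset.sum_congr rfl fun t _ => by rw [map_mul, Complex.conj_ofReal]
  have hcol : ∀ t, ∑ s, (K s t : ℂ) * v s = -(I * μ * v t) := by
    intro t
    rw [← heig t, ← Finset.sum_neg_distrib]
    exact Finset.sum_congr rfl fun s _ => by rw [hanti t s]; push_cast; ring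
  have hsplit : ∀ s t, v s * conj (v t) * ((K s t * (P s - P t) : ℝ) : ℂ) =
      v s * (P s : ℂ) * ((K s t : ℂ) * conj (v t)) - conj (v t) * (P t : ℂ) * ((K s t : ℂ) * v s) := by
    intro s t; push_cast; ring
  simp_rw [hsplit]
  rw [Finset.sum_comm]
  simp only [Finset.sum_sub_distrib]
  rw [Finset.sum_comm]
  simp_rw [← Finset.mul_sum, hrow, hcol]
  simp only [map_mul, Complex.conj_I, Complex.conj_ofReal]
  rw [← Finset.sum_sub_distrib]
  exact Finset.sum_eq_zero fun s _ => by ring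

/-- **Pan–Pan (33)–(35)**: for a unit eigenvector `Kv = iμv` of the weighted Hilbert kernel,
`μ² ≤ 4 + 2Σ₇` with `Σ₇ = ∑_{s,t} |v_s||v_t| c_s c_t δ_t/(x_s-x_t)²`.
[cite: PanPan1991, Ch. 28 §4 Theorem 4] -/
theorem mu_sq_le_four_add (hδ : ∀ r, 0 < δ r) (hsep : ∀ r s, r ≠ s → δ r ≤ |x r - x s|)
    (hc : ∀ r, c r = Real.sqrt (δ r)) (hK : ∀ r s, K r s = c r * c s / (x r - x s))
    (v : ι → ℂ) (μ : ℝ) (hv : ∑ r, ‖v r‖ ^ 2 = 1)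
    (heig : ∀ r, ∑ s, (K r s : ℂ) * v s = I * μ * v r) :
    μ ^ 2 ≤ 4 + 2 * ∑ s, ∑ t, ‖v s‖ * ‖v t‖ * (c s * c t * δ t / (x s - x t) ^ 2) := by
  have hc0 : ∀ r, 0 < c r := fun r => by rw [hc]; exact Real.sqrt_pos.mpr (hδ r)
  have hanti : ∀ s t, K t s = -K s t := by
    intro s t; rw [hK, hK, show x t - x s = -(x s - x t) by ring, div_neg]; ring
  -- the three pieces
  set D : ι → ℝ := fun s => δ s * ∑ r, δ r / (x r - x s) ^ 2 with hD
  set P : ι → ℝ := fun u => ∑ r, δ r / (x r - x u) with hP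
  set E : ι → ι → ℝ := fun s t => c s * c t * (δ s + δ t) / (x s - x t) ^ 2 with hE
  have hM : ∀ s t, ((∑ r, K r s * K r t : ℝ) : ℂ) =
      ((if s = t then D s else 0 : ℝ) : ℂ) + ((K s t * (P s - P t) : ℝ) : ℂ) + (E s t : ℂ) := by
    intro s t
    rw [sum_kernel_mul_kernel hδ hsep hc hK s t]
    push_cast
    simp only [hD, hP, hE]
    split_ifs <;> push_cast <;> ring
  have hμ := mu_sq_eq_sum v μ hv heig
  simp_rw [hM, mul_add, Finset.sum_add_distrib] at hμ
  rw [sum_cross_eq_zero hanti P v μ heig, add_zero] at hμ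
  -- the diagonal piece
  have hdiag : ∑ s, ∑ t, v s * conj (v t) * ((if s = t then D s else 0 : ℝ) : ℂ) =
      ((∑ s, ‖v s‖ ^ 2 * D s : ℝ) : ℂ) := by
    push_cast
    refine Finset.sum_congr rfl fun s _ => ?_
    rw [Finset.sum_eq_single s]
    · simp only [if_true]
      rw [Complex.mul_conj, Complex.normSq_eq_norm_sq]; push_cast; ring
    · intro t _ hts; simp [Ne.symm hts]
    · simp
  rw [hdiag] at hμ
  have hD4 : ∑ s, ‖v s‖ ^ 2 * D s ≤ 4 := by
    calc ∑ s, ‖v s‖ ^ 2 * D s ≤ ∑ s, ‖v s‖ ^ 2 * 4 := by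
          refine Finset.sum_le_sum fun s _ => ?_
          refine mul_le_mul_of_nonneg_left ?_ (by positivity)
          simp only [hD]
          calc δ s * ∑ r, δ r / (x r - x s) ^ 2 ≤ δ s * (4 / δ s) :=
                mul_le_mul_of_nonneg_left (sum_univ_weight_div_sq_le hδ hsep s) (hδ s).le
            _ = 4 := by field_simp [(hδ s).ne']
      _ = 4 := by rw [← Finset.sum_mul, hv, one_mul]
  -- the off-diagonal piece
  have hE0 : ∀ s t, 0 ≤ E s t := fun s t => by
    simp only [hE]; have := hc0 s; have := hc0 t; have := hδ s; have := hδ t; positivity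
  have hoff : ‖∑ s, ∑ t, v s * conj (v t) * (E s t : ℂ)‖ ≤
      2 * ∑ s, ∑ t, ‖v s‖ * ‖v t‖ * (c s * c t * δ t / (x s - x t) ^ 2) := by
    calc ‖∑ s, ∑ t, v s * conj (v t) * (E s t : ℂ)‖
          ≤ ∑ s, ∑ t, ‖v s‖ * ‖v t‖ * E s t := by
            refine (norm_sum_le _ _).trans (Finset.sum_le_sum fun s _ => ?_)
            refine (norm_sum_le _ _).trans (Finset.sum_le_sum fun t _ => le_of_eq ?_)
            rw [norm_mul, norm_mul, Complex.norm_conj, Complex.norm_real, Real.norm_of_nonneg (hE0 s t)]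
      _ = ∑ s, ∑ t, ‖v s‖ * ‖v t‖ * (c s * c t * δ s / (x s - x t) ^ 2) +
            ∑ s, ∑ t, ‖v s‖ * ‖v t‖ * (c s * c t * δ t / (x s - x t) ^ 2) := by
            rw [← Finset.sum_add_distrib]
            refine Finset.sum_congr rfl fun s _ => ?_
            rw [← Finset.sum_add_distrib]
            refine Finset.sum_congr rfl fun t _ => ?_
            simp only [hE]; ring
      _ = 2 * ∑ s, ∑ t, ‖v s‖ * ‖v t‖ * (c s * c t * δ t / (x s - x t) ^ 2) := by
            rw [two_mul]
            congr 1
            rw [Finset.sum_comm]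
            refine Finset.sum_congr rfl fun s _ => Finset.sum_congr rfl fun t _ => ?_
            rw [show (x t - x s) ^ 2 = (x s - x t) ^ 2 by ring]
            ring
  -- assemble
  have hreal : μ ^ 2 = ‖((μ ^ 2 : ℝ) : ℂ)‖ := by
    rw [Complex.norm_real, Real.norm_of_nonneg (sq_nonneg μ)]
  rw [hreal, hμ]
  refine (norm_add_le _ _).trans ?_
  rw [Complex.norm_real, Real.norm_of_nonneg (Finset.sum_nonneg fun s _ => by
    have : 0 ≤ D s := by
      simp only [hD]
      exact mul_nonneg (hδ s).le (Finset.sum_nonneg fun r _ => div_nonneg (hδ r).le (sq_nonneg _))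
    positivity)]
  linarith

/-- **Pan–Pan, bound for `Σ₇`**: `Σ₇² ≤ 16/3 + 8Σ₇` (Cauchy–Schwarz, then the exponent-4 one-pole
sum on the diagonal and the two-pole sum off it). [cite: PanPan1991, Ch. 28 §4 Theorem 4] -/
theorem sigma_seven_sq_le (hδ : ∀ r, 0 < δ r) (hsep : ∀ r s, r ≠ s → δ r ≤ |x r - x s|)
    (hc : ∀ r, c r = Real.sqrt (δ r)) (v : ι → ℂ) (hv : ∑ r, ‖v r‖ ^ 2 = 1) :
    (∑ s, ∑ t, ‖v s‖ * ‖v t‖ * (c s * c t * δ t / (x s - x t) ^ 2)) ^ 2 ≤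
      16 / 3 + 8 * ∑ s, ∑ t, ‖v s‖ * ‖v t‖ * (c s * c t * δ t / (x s - x t) ^ 2) := by
  have hinj := injective_of_sep hδ hsep
  have hc0 : ∀ r, 0 < c r := fun r => by rw [hc]; exact Real.sqrt_pos.mpr (hδ r)
  have hcsq : ∀ r, c r ^ 2 = δ r := fun r => by rw [hc]; exact Real.sq_sqrt (hδ r).le
  set S7 := ∑ s, ∑ t, ‖v s‖ * ‖v t‖ * (c s * c t * δ t / (x s - x t) ^ 2) with hS7
  set w : ι → ℝ := fun t => ‖v t‖ * c t * δ t with hw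
  have hw0 : ∀ t, 0 ≤ w t := fun t => by
    simp only [hw]; have := hc0 t; have := hδ t; positivity
  -- Cauchy–Schwarz
  have hCS : S7 ^ 2 ≤ ∑ s, δ s * (∑ t, w t / (x s - x t) ^ 2) ^ 2 := by
    have hrw : S7 = ∑ s, ‖v s‖ * (c s * ∑ t, w t / (x s - x t) ^ 2) := by
      simp only [hS7, hw]
      refine Finset.sum_congr rfl fun s _ => ?_
      rw [Finset.mul_sum, Finset.mul_sum]
      exact Finset.sum_congr rfl fun t _ => by ring
    rw [hrw]
    refine (Finset.sum_mul_sq_le_sq_mul_sq _ _ _).trans ?_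
    rw [hv, one_mul]
    refine le_of_eq (Finset.sum_congr rfl fun s _ => ?_)
    rw [mul_pow, hcsq]
  -- expand the square
  set N : ι → ι → ℝ := fun t q => ∑ s, δ s / ((x s - x t) ^ 2 * (x s - x q) ^ 2) with hN
  have hexp : ∑ s, δ s * (∑ t, w t / (x s - x t) ^ 2) ^ 2 = ∑ t, ∑ q, w t * w q * N t q := by
    calc ∑ s, δ s * (∑ t, w t / (x s - x t) ^ 2) ^ 2
        = ∑ s, ∑ t, ∑ q, w t * w q * (δ s / ((x s - x t) ^ 2 * (x s - x q) ^ 2)) := by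
          refine Finset.sum_congr rfl fun s _ => ?_
          rw [sq, Finset.sum_mul_sum, Finset.mul_sum]
          refine Finset.sum_congr rfl fun t _ => ?_
          rw [Finset.mul_sum]
          refine Finset.sum_congr rfl fun q _ => ?_
          rw [div_mul_div_comm, mul_div_assoc]
          ring
      _ = ∑ t, ∑ q, ∑ s, w t * w q * (δ s / ((x s - x t) ^ 2 * (x s - x q) ^ 2)) := by
          rw [Finset.sum_comm]
          refine Finset.sum_congr rfl fun t _ => ?_
          rw [Finset.sum_comm]
      _ = ∑ t, ∑ q, w t * w q * N t q := by
          refine Finset.sum_congr rfl fun t _ => Finset.sum_congr rfl fun q _ => ?_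
          simp only [hN]
          rw [Finset.mul_sum]
  -- bound the inner spacing sums
  have hNB : ∀ t q, N t q ≤
      (if t = q then 16 / (3 * δ t ^ 3) else 0) + 4 * (1 / δ t + 1 / δ q) / (x t - x q) ^ 2 := by
    intro t q
    by_cases htq : t = q
    · subst htq
      simp only [if_true, sub_self, ne_eq, OfNat.ofNat_ne_zero, not_false_eq_true, zero_pow,
        div_zero, add_zero, hN]
      calc ∑ s, δ s / ((x s - x t) ^ 2 * (x s - x t) ^ 2) = ∑ s, δ s / (x s - x t) ^ 4 :=
            Finset.sum_congr rfl fun s _ => by ring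
        _ ≤ 16 / (3 * δ t ^ 3) := sum_univ_weight_div_pow_four_le hδ hsep t
    · simp only [htq, if_false, zero_add, hN]
      exact sum_univ_two_pole_le hδ hsep htq
  have hW : ∑ t, ∑ q, w t * w q * N t q ≤ 16 / 3 + 8 * S7 := by
    calc ∑ t, ∑ q, w t * w q * N t q
        ≤ ∑ t, ∑ q, w t * w q *
            ((if t = q then 16 / (3 * δ t ^ 3) else 0) + 4 * (1 / δ t + 1 / δ q) / (x t - x q) ^ 2) :=
          Finset.sum_le_sum fun t _ => Finset.sum_le_sum fun q _ =>
            mul_le_mul_of_nonneg_left (hNB t q) (mul_nonneg (hw0 t) (hw0 q))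
      _ = ∑ t, w t * w t * (16 / (3 * δ t ^ 3)) +
            ∑ t, ∑ q, w t * w q * (4 * (1 / δ t + 1 / δ q) / (x t - x q) ^ 2) := by
          rw [← Finset.sum_add_distrib]
          refine Finset.sum_congr rfl fun t _ => ?_
          have : ∀ q, w t * w q * ((if t = q then 16 / (3 * δ t ^ 3) else 0) +
              4 * (1 / δ t + 1 / δ q) / (x t - x q) ^ 2) =
              (if t = q then w t * w t * (16 / (3 * δ t ^ 3)) else 0) +
                w t * w q * (4 * (1 / δ t + 1 / δ q) / (x t - x q) ^ 2) := by
            intro q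
            split_ifs with h
            · subst h; ring
            · ring
          simp_rw [this]
          rw [Finset.sum_add_distrib, Finset.sum_ite_eq]
          simp
      _ = 16 / 3 + 8 * S7 := by
          congr 1
          · calc ∑ t, w t * w t * (16 / (3 * δ t ^ 3)) = ∑ t, ‖v t‖ ^ 2 * (16 / 3) := by
                  refine Finset.sum_congr rfl fun t _ => ?_
                  simp only [hw]
                  rw [← hcsq t]
                  have := (hc0 t).ne'
                  field_simp
              _ = 16 / 3 := by rw [← Finset.sum_mul, hv, one_mul]
          · have h4 : ∀ t q, w t * w q * (4 * (1 / δ t + 1 / δ q) / (x t - x q) ^ 2) =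
                4 * (‖v t‖ * ‖v q‖ * (c t * c q * δ q / (x t - x q) ^ 2)) +
                  4 * (‖v t‖ * ‖v q‖ * (c t * c q * δ t / (x t - x q) ^ 2)) := by
              intro t q
              simp only [hw]
              have := (hδ t).ne'
              have := (hδ q).ne'
              by_cases htq : x t - x q = 0
              · rw [htq]; simp
              · field_simp
            simp_rw [h4, Finset.sum_add_distrib, ← Finset.mul_sum]
            have hswap : ∑ t, ∑ q, ‖v t‖ * ‖v q‖ * (c t * c q * δ t / (x t - x q) ^ 2) = S7 := by
              simp only [hS7]
              rw [Finset.sum_comm]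
              refine Finset.sum_congr rfl fun s _ => Finset.sum_congr rfl fun t _ => ?_
              rw [show (x t - x s) ^ 2 = (x s - x t) ^ 2 by ring]
              ring
            rw [hswap]
            ring
  calc S7 ^ 2 ≤ _ := hCS
    _ = _ := hexp
    _ ≤ 16 / 3 + 8 * S7 := hW

/-- **Pan–Pan, Ch. 28 §4, Theorem 4 (eigenvalue form, crude constants)**: for a unit eigenvector
`Kv = iμv` of the weighted Hilbert kernel of a `δ`-separated configuration, `μ² ≤ 107/5`
(`Σ₇ ≤ 87/10` from `Σ₇² ≤ 16/3 + 8Σ₇`, and `μ² ≤ 4 + 2Σ₇`). [cite: PanPan1991, Ch. 28 §4 Theorem 4] -/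
theorem mu_sq_le (hδ : ∀ r, 0 < δ r) (hsep : ∀ r s, r ≠ s → δ r ≤ |x r - x s|)
    (hc : ∀ r, c r = Real.sqrt (δ r)) (hK : ∀ r s, K r s = c r * c s / (x r - x s))
    (v : ι → ℂ) (μ : ℝ) (hv : ∑ r, ‖v r‖ ^ 2 = 1)
    (heig : ∀ r, ∑ s, (K r s : ℂ) * v s = I * μ * v r) : μ ^ 2 ≤ 107 / 5 := by
  have h1 := mu_sq_le_four_add hδ hsep hc hK v μ hv heig; have h2 := sigma_seven_sq_le hδ hsep hc v hv
  have hc0 : ∀ r, 0 < c r := fun r => by rw [hc]; exact Real.sqrt_pos.mpr (hδ r)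
  set S7 := ∑ s, ∑ t, ‖v s‖ * ‖v t‖ * (c s * c t * δ t / (x s - x t) ^ 2) with hS7
  have hS70 : 0 ≤ S7 := Finset.sum_nonneg fun s _ => Finset.sum_nonneg fun t _ => by
    have := hc0 s; have := hc0 t; have := hδ t; positivity
  have hS7 : S7 ≤ 87 / 10 := by nlinarith
  linarith

/-- The eigenvalue bound in the form used downstream: `|μ| ≤ 3π/2` (as `107/5 < 9·3.14²/4`).
[cite: PanPan1991, Ch. 28 §4 Theorem 4] -/
theorem abs_mu_le (hδ : ∀ r, 0 < δ r) (hsep : ∀ r s, r ≠ s → δ r ≤ |x r - x s|)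
    (hc : ∀ r, c r = Real.sqrt (δ r)) (hK : ∀ r s, K r s = c r * c s / (x r - x s))
    (v : ι → ℂ) (μ : ℝ) (hv : ∑ r, ‖v r‖ ^ 2 = 1)
    (heig : ∀ r, ∑ s, (K r s : ℂ) * v s = I * μ * v r) : |μ| ≤ 3 * π / 2 := by
  have h := mu_sq_le hδ hsep hc hK v μ hv heig
  have hpi := Real.pi_gt_d2
  have h' : μ ^ 2 ≤ (3 * π / 2) ^ 2 := by nlinarith
  exact abs_le.mpr ⟨by nlinarith, by nlinarith⟩

end Core

end Literature.NumberTheory.LFunctions.MontgomeryVaughan
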